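import Literature.NumberTheory.DiophantineGeometry.AbcWave0GranvilleStarkHeights
import HarnessLib

/-!
# Three `𝓞_K`-linear forms in two coprime integers: gcd, radical-norm and height bookkeeping

`Summits/ABC/ABC/Theorems/CuspFieldPencilNFPencilThreeFormsLemmas.lean` — route-independent lemmas
(no `Theses` import) for LINE 17 step (5), the helper `nfPencilBound_of_scoones2021` toward the crux
stmt-ABC-26250 `Summit.ABC.ABC.Theses.CuspFieldPencil.NFPencilBound`
(file `CuspFieldPencilNFPencilBoundOfScoones.lean`). Everything here is unconditional [folklore]
bookkeeping over a number field `K` (resp. a PID), in the vocabulary of the tree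
(`Literature.NumberTheory.DiophantineGeometry.badPrimes` / `radicalNorm` = Granville–Stark conductor,
each prime once) and of Mathlib's relative multiplicative height `Height.mulHeight`
(`NumberField.mulHeight_eq`, `NumberField.absNorm_mul_finprod_finitePlace_eq_one`):

* §1 `cyclic_identity`, `minor_mul_left/right` — the determinant identities of three binary forms
  `Lᵢ = αᵢu + βᵢw`: `δ₁₂L₀ + δ₂₀L₁ + δ₀₁L₂ = 0`, `δ₀₁u = β₁L₀ − β₀L₁`, `δ₀₁w = α₀L₁ − α₁L₀`.
* §2 `exists_eq_mul_isCoprime` — in a PID, `A = g·a`, `B = g·b` with `(a, b) = 1`;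
  `isCoprime_of_add_add_eq_zero_left/right` — `a + b + c = 0`, `(a,b) = 1 ⇒ (b,c) = (c,a) = 1`.
* §3 `absNorm_radical_mul_le` (`N(rad(IJ)) ≤ N(rad I)·N(rad J)`), `absNorm_radical_span_mul_le`,
  `radicalNorm_le_absNorm_radical` — for `h_K = 1`, if `a, b, c ∣ P ≠ 0` then
  `N_K(a,b,c) ≤ N(rad(P𝓞_K))` (tree `badPrimes_subset_of_forall`, `radicalNorm_le_absNorm_span`).
* §4 `prod_infinitePlace_iSup_pow_mult_eq` (places with multiplicity = embeddings, tuple version),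
  `abs_pow_finrank_le_mulHeight` — if `l ≠ 0` lies in the ideal `(x₀,x₁,x₂)` and `l·m = Σ cᵢxᵢ`
  for a rational integer `m`, then `|m|^[K:ℚ] ≤ (∏_σ Σᵢ|σcᵢ|) · H_K(x)`.
* §5 `log_le_of_pow_le`, `max_pow_le` — final real arithmetic.

HONESTY. Lemmas only; they prove no item; class-record bookkeeping at abc distance 0 (width 0);
NOT abc, NOT A-PS; abc moved by 0; typed ≠ proved.

References: Granville–Stark, Invent. Math. 139 (2000) §2 (conductor vs norm, via the tree file
`AbcWave0GranvilleStarkHeights`); Marcus, *Number Fields*, Ch. 3 (ideals in Dedekind domains);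
[folklore].
-/

set_option linter.dupNamespace false

namespace Summit.ABC.ABC.Theorems

open NumberField Height
open Literature.NumberTheory.DiophantineGeometry

namespace NFPencilThreeForms

/-! ## §1 Algebra of three binary linear forms -/

/-- The cyclic determinant identity: for three binary linear forms `Lᵢ = αᵢu + βᵢw`,
`δ₁₂L₀ + δ₂₀L₁ + δ₀₁L₂ = 0` with `δᵢⱼ = αᵢβⱼ − αⱼβᵢ`. [folklore] -/
theorem cyclic_identity {R : Type*} [CommRing R] (α β : Fin 3 → R) (u w : R) :
    (α 1 * β 2 - α 2 * β 1) * (α 0 * u + β 0 * w) +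
      (α 2 * β 0 - α 0 * β 2) * (α 1 * u + β 1 * w) +
        (α 0 * β 1 - α 1 * β 0) * (α 2 * u + β 2 * w) = 0 := by
  ring

/-- Elimination of `w`: `δ₀₁·u = β₁L₀ − β₀L₁`. [folklore] -/
theorem minor_mul_left {R : Type*} [CommRing R] (α β : Fin 3 → R) (u w : R) :
    (α 0 * β 1 - α 1 * β 0) * u = β 1 * (α 0 * u + β 0 * w) - β 0 * (α 1 * u + β 1 * w) := by
  ring

/-- Elimination of `u`: `δ₀₁·w = α₀L₁ − α₁L₀`. [folklore] -/
theorem minor_mul_right {R : Type*} [CommRing R] (α β : Fin 3 → R) (u w : R) :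
    (α 0 * β 1 - α 1 * β 0) * w = α 0 * (α 1 * u + β 1 * w) - α 1 * (α 0 * u + β 0 * w) := by
  ring

/-! ## §2 Dividing by the gcd in a principal ideal domain -/

/-- In a principal ideal domain, two elements `A ≠ 0`, `B` can be written `A = g·a`, `B = g·b`
with `a, b` coprime in the Bézout sense (`g` a generator of `(A, B)`). [folklore] -/
theorem exists_eq_mul_isCoprime {R : Type*} [CommRing R] [IsDomain R] [IsPrincipalIdealRing R]
    (A B : R) (hA : A ≠ 0) :
    ∃ g a b : R, A = g * a ∧ B = g * b ∧ IsCoprime a b := by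
  obtain ⟨g, hg⟩ := (IsPrincipalIdealRing.principal (Ideal.span ({A, B} : Set R))).principal
  have hgI : Ideal.span ({A, B} : Set R) = Ideal.span {g} := hg
  have hAmem : A ∈ Ideal.span {g} := hgI ▸ Ideal.subset_span (by simp)
  have hBmem : B ∈ Ideal.span {g} := hgI ▸ Ideal.subset_span (by simp)
  obtain ⟨a, ha⟩ := Ideal.mem_span_singleton'.mp hAmem
  obtain ⟨b, hb⟩ := Ideal.mem_span_singleton'.mp hBmem
  have hgmem : g ∈ Ideal.span ({A, B} : Set R) := hgI ▸ Ideal.mem_span_singleton_self g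
  obtain ⟨p, q, hpq⟩ := Ideal.mem_span_pair.mp hgmem
  have hg0 : g ≠ 0 := by
    rintro rfl
    exact hA (by rw [← ha, mul_zero])
  refine ⟨g, a, b, by rw [← ha, mul_comm], by rw [← hb, mul_comm], p, q, ?_⟩
  have h1 : g * (p * a + q * b) = g * 1 := by
    rw [mul_one]
    nth_rewrite 2 [← hpq]
    rw [← ha, ← hb]
    ring
  exact mul_left_cancel₀ hg0 h1

/-- From `a + b + c = 0` and `(a, b) = 1`: `(b, c) = 1`. [folklore] -/
theorem isCoprime_of_add_add_eq_zero_left {R : Type*} [CommRing R] {a b c : R}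
    (h : a + b + c = 0) (hab : IsCoprime a b) : IsCoprime b c := by
  obtain ⟨p, q, hpq⟩ := hab
  exact ⟨q - p, -p, by linear_combination hpq - p * h⟩

/-- From `a + b + c = 0` and `(a, b) = 1`: `(c, a) = 1`. [folklore] -/
theorem isCoprime_of_add_add_eq_zero_right {R : Type*} [CommRing R] {a b c : R}
    (h : a + b + c = 0) (hab : IsCoprime a b) : IsCoprime c a := by
  obtain ⟨p, q, hpq⟩ := hab
  exact ⟨-q, p - q, by linear_combination hpq - q * h⟩

/-! ## §3 The radical norm of the reduced triple -/

section Radical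

variable {K : Type*} [Field K] [NumberField K]

/-- Sub-multiplicativity of the norm of the radical: `N(rad(IJ)) ≤ N(rad I)·N(rad J)` for nonzero
ideals of `𝓞 K` (`rad I · rad J ⊆ rad I ∩ rad J = rad(IJ)`). [folklore] -/
theorem absNorm_radical_mul_le {I J : Ideal (𝓞 K)} (hI : I ≠ ⊥) (hJ : J ≠ ⊥) :
    Ideal.absNorm (I * J).radical ≤ Ideal.absNorm I.radical * Ideal.absNorm J.radical := by
  have hle : I.radical * J.radical ≤ (I * J).radical := by
    rw [Ideal.radical_mul]
    exact Ideal.mul_le_inf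
  have hdvd := Ideal.absNorm_dvd_absNorm_of_le hle
  rw [map_mul] at hdvd
  refine Nat.le_of_dvd (Nat.pos_of_ne_zero ?_) hdvd
  have hI' : Ideal.absNorm I.radical ≠ 0 := by
    rw [Ne, Ideal.absNorm_eq_zero_iff]
    exact fun h => hI (le_bot_iff.mp (Ideal.le_radical.trans h.le))
  have hJ' : Ideal.absNorm J.radical ≠ 0 := by
    rw [Ne, Ideal.absNorm_eq_zero_iff]
    exact fun h => hJ (le_bot_iff.mp (Ideal.le_radical.trans h.le))
  exact mul_ne_zero hI' hJ'

/-- `N(rad((x·y))) ≤ N(rad((x)))·N(rad((y)))` for nonzero `x, y ∈ 𝓞 K`. [folklore] -/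
theorem absNorm_radical_span_mul_le {x y : 𝓞 K} (hx : x ≠ 0) (hy : y ≠ 0) :
    Ideal.absNorm (Ideal.span {x * y}).radical ≤
      Ideal.absNorm (Ideal.span {x}).radical * Ideal.absNorm (Ideal.span {y}).radical := by
  rw [← Ideal.span_singleton_mul_span_singleton]
  exact absNorm_radical_mul_le (by rwa [Ne, Ideal.span_singleton_eq_bot])
    (by rwa [Ne, Ideal.span_singleton_eq_bot])

/-- In a class-number-one `𝓞 K`: if each of `a, b, c` divides a nonzero `P ∈ 𝓞 K`, then the radical
norm (Granville–Stark conductor, each prime once) of `(a : b : c)` is at most `N(rad(P𝓞_K))` — every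
bad prime contains one of `a, b, c`, hence `P`, hence the generator of `rad(P𝓞_K)`. [folklore] -/
theorem radicalNorm_le_absNorm_radical (hPID : IsPrincipalIdealRing (𝓞 K)) {a b c P : 𝓞 K}
    (hP : P ≠ 0) (ha : a ∣ P) (hb : b ∣ P) (hc : c ∣ P) :
    radicalNorm (a : K) (b : K) (c : K) ≤ Ideal.absNorm (Ideal.span {P}).radical := by
  obtain ⟨s, hs⟩ := (IsPrincipalIdealRing.principal (Ideal.span {P}).radical).principal
  have hsI : (Ideal.span {P}).radical = Ideal.span {s} := hs
  have hs0 : s ≠ 0 := by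
    rintro rfl
    have : Ideal.span {P} ≤ ⊥ := by
      have h := (Ideal.le_radical : Ideal.span {P} ≤ (Ideal.span {P}).radical)
      rw [hsI, Ideal.span_singleton_eq_bot.mpr rfl] at h
      exact h
    exact hP (Ideal.span_singleton_eq_bot.mp (le_bot_iff.mp this))
  have key : ∀ (v : IsDedekindDomain.HeightOneSpectrum (𝓞 K)) (d : 𝓞 K), d ∣ P →
      d ∈ v.asIdeal → s ∈ v.asIdeal := by
    intro v d hd hdv
    have hPv : P ∈ v.asIdeal := Ideal.mem_of_dvd _ hd hdv
    have h1 : Ideal.span {P} ≤ v.asIdeal := (Ideal.span_singleton_le_iff_mem _).mpr hPv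
    have h2 : (Ideal.span {P}).radical ≤ v.asIdeal := (Ideal.IsPrime.radical_le_iff v.isPrime).mpr h1
    rw [hsI, Ideal.span_singleton_le_iff_mem] at h2
    exact h2
  have hsub : badPrimes (a : K) b c ⊆ {v | s ∈ v.asIdeal} := by
    refine badPrimes_subset_of_forall fun v hv => ⟨?_, ?_, ?_⟩
    · exact fun h => hv (key v a ha h)
    · exact fun h => hv (key v b hb h)
    · exact fun h => hv (key v c hc h)
  rw [hsI]
  exact radicalNorm_le_absNorm_span hs0 hsub

end Radical

/-! ## §4 Heights: `log max(|u|,|w|) ≤ log H_K + O(1)` -/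

section Height

variable {K : Type*} [Field K] [NumberField K]

/-- **Places with multiplicity are embeddings (tuple version).** For `x : ι → K`:
`∏_{w ∣ ∞} (sup_i |x_i|_w)^{mult w} = ∏_{σ : K →+* ℂ} sup_i |σ x_i|` (each infinite place `w` is
`|σ ·|` for exactly `mult w` embeddings `σ`, Mathlib `InfinitePlace.card_filter_mk_eq`). [folklore] -/
theorem prod_infinitePlace_iSup_pow_mult_eq {ι : Type*} [Finite ι] (x : ι → K) :
    ∏ w : InfinitePlace K, (⨆ i, w (x i)) ^ w.mult = ∏ φ : K →+* ℂ, ⨆ i, ‖φ (x i)‖ := by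
  classical
  rw [← Finset.prod_fiberwise Finset.univ InfinitePlace.mk (fun φ : K →+* ℂ => ⨆ i, ‖φ (x i)‖)]
  refine Finset.prod_congr rfl fun w _ => ?_
  have (φ) (hφ : φ ∈ ({φ | InfinitePlace.mk φ = w} : Finset _)) :
      (⨆ i, ‖φ (x i)‖) = ⨆ i, w (x i) := by
    rw [← (Finset.mem_filter.mp hφ).2]
    simp_rw [InfinitePlace.apply]
  rw [Finset.prod_congr rfl this, Finset.prod_const, InfinitePlace.card_filter_mk_eq]

/-- **A rational integer represented on an integral tuple is bounded by its height.** Let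
`x : Fin 3 → 𝓞 K` be a nonzero tuple of algebraic integers, `l ≠ 0` an algebraic integer in the
ideal `(x₀, x₁, x₂)`, and `m ∈ ℤ` with `l·m = Σ cᵢ xᵢ`. Then
`|m|^[K:ℚ] ≤ (∏_σ Σᵢ |σ cᵢ|) · H_K(x)`, `H_K = Height.mulHeight` (relative multiplicative height):
at each embedding `|σ l|·|m| ≤ (Σ|σcᵢ|)·maxᵢ|σxᵢ|`; multiplying over `σ` gives
`|N(l)|·|m|^n ≤ E · (archimedean part)`, while the non-archimedean part of `H_K(x)` is
`N((x₀,x₁,x₂))⁻¹ ≥ |N(l)|⁻¹` (Mathlib `NumberField.absNorm_mul_finprod_finitePlace_eq_one`).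
[folklore] -/
theorem abs_pow_finrank_le_mulHeight {x : Fin 3 → 𝓞 K} (hx : x ≠ 0) {l : 𝓞 K} (hl0 : l ≠ 0)
    (hl : l ∈ Ideal.span (Set.range x)) {m : ℤ} {c : Fin 3 → 𝓞 K}
    (hm : l * (m : 𝓞 K) = ∑ i, c i * x i) :
    |(m : ℝ)| ^ Module.finrank ℚ K ≤
      (∏ φ : K →+* ℂ, ∑ i, ‖φ (c i)‖) * mulHeight (fun i => (x i : K)) := by
  classical
  set xK : Fin 3 → K := fun i => (x i : K) with hxK
  have hxK0 : xK ≠ 0 := by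
    intro h
    apply hx
    funext i
    have := congrFun h i
    simpa [hxK] using this
  -- per-embedding estimate
  have hφ : ∀ φ : K →+* ℂ, ‖φ l‖ * |(m : ℝ)| ≤ (∑ i, ‖φ (c i)‖) * ⨆ i, ‖φ (xK i)‖ := by
    intro φ
    have hM : ∀ i, ‖φ (xK i)‖ ≤ ⨆ i, ‖φ (xK i)‖ := fun i =>
      le_ciSup (f := fun i => ‖φ (xK i)‖) (Finite.bddAbove_range _) i
    have e1 : ‖φ l‖ * |(m : ℝ)| = ‖φ ((l * (m : 𝓞 K) : 𝓞 K) : K)‖ := by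
      simp only [map_mul, map_intCast, norm_mul, Complex.norm_intCast]
    rw [e1, hm]
    push_cast
    rw [map_sum]
    calc ‖∑ i, φ ((c i : K) * (x i : K))‖
        ≤ ∑ i, ‖φ ((c i : K) * (x i : K))‖ := norm_sum_le _ _
      _ = ∑ i, ‖φ (c i)‖ * ‖φ (xK i)‖ := by simp_rw [map_mul, norm_mul, hxK]
      _ ≤ ∑ i, ‖φ (c i)‖ * ⨆ i, ‖φ (xK i)‖ :=
          Finset.sum_le_sum fun i _ => mul_le_mul_of_nonneg_left (hM i) (norm_nonneg _)
      _ = (∑ i, ‖φ (c i)‖) * ⨆ i, ‖φ (xK i)‖ := by rw [Finset.sum_mul]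
  -- product over the embeddings
  set A := ∏ φ : K →+* ℂ, ⨆ i, ‖φ (xK i)‖ with hA
  set E := ∏ φ : K →+* ℂ, ∑ i, ‖φ (c i)‖ with hE
  have hpow : |(m : ℝ)| ^ Module.finrank ℚ K = ∏ _φ : K →+* ℂ, |(m : ℝ)| := by
    rw [Finset.prod_const, Finset.card_univ, NumberField.Embeddings.card]
  have hprod : (∏ φ : K →+* ℂ, ‖φ l‖) * |(m : ℝ)| ^ Module.finrank ℚ K ≤ E * A := by
    rw [hpow, hE, hA, ← Finset.prod_mul_distrib, ← Finset.prod_mul_distrib]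
    exact Finset.prod_le_prod (fun φ _ => by positivity) fun φ _ => hφ φ
  have hNl : (∏ φ : K →+* ℂ, ‖φ l‖) = (Ideal.absNorm (Ideal.span {l}) : ℝ) :=
    (absNorm_span_singleton_eq_prod_embeddings l).symm
  have harch : ∏ w : InfinitePlace K, (⨆ i, w (xK i)) ^ w.mult = A :=
    prod_infinitePlace_iSup_pow_mult_eq xK
  -- the finite part
  have hfin := NumberField.absNorm_mul_finprod_finitePlace_eq_one hx
  set N := Ideal.absNorm (Ideal.span (Set.range x)) with hN
  set FP := ∏ᶠ v : FinitePlace K, ⨆ i, v (xK i) with hFP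
  have hfin' : (N : ℝ) * FP = 1 := hfin
  have hNl0 : Ideal.absNorm (Ideal.span {l}) ≠ 0 := by
    rw [Ne, Ideal.absNorm_eq_zero_iff, Ideal.span_singleton_eq_bot]
    exact hl0
  have hNdvd : N ∣ Ideal.absNorm (Ideal.span {l}) :=
    Ideal.absNorm_dvd_absNorm_of_le ((Ideal.span_singleton_le_iff_mem _).mpr hl)
  have hNle : (N : ℝ) ≤ Ideal.absNorm (Ideal.span {l}) := by
    exact_mod_cast Nat.le_of_dvd (Nat.pos_of_ne_zero hNl0) hNdvd
  have hN0 : N ≠ 0 := by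
    intro h0
    rw [h0, Nat.cast_zero, zero_mul] at hfin'
    exact zero_ne_one hfin'
  have hNpos : (0 : ℝ) < N := by positivity
  have hNlpos : (0 : ℝ) < Ideal.absNorm (Ideal.span {l}) := by positivity
  have hA0 : 0 ≤ A := Finset.prod_nonneg fun φ _ => Real.iSup_nonneg fun i => norm_nonneg _
  have hE0 : 0 ≤ E := Finset.prod_nonneg fun φ _ => Finset.sum_nonneg fun i _ => norm_nonneg _
  have hFPeq : FP = ((N : ℝ))⁻¹ := eq_inv_of_mul_eq_one_right hfin'
  rw [NumberField.mulHeight_eq hxK0, harch]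
  rw [hNl] at hprod
  calc |(m : ℝ)| ^ Module.finrank ℚ K
      ≤ E * A / (Ideal.absNorm (Ideal.span {l}) : ℝ) := by
        rw [le_div_iff₀ hNlpos]
        linarith [hprod]
    _ ≤ E * A / N := by gcongr
    _ = E * (A * FP) := by
        rw [hFPeq]
        ring

end Height

/-! ## §5 Final real arithmetic -/

/-- Final bookkeeping: from `M^n ≤ F·H` (`M ≥ 0` an integer, `n ≥ 1`), `log H ≤ B·X` with `B ≥ 0`,
`X ≥ 1`: `log M ≤ (|log F| + B)·X`. [folklore] -/
theorem log_le_of_pow_le {n : ℕ} (hn : n ≠ 0) {M : ℤ} (hM : 0 ≤ M) {F H B X : ℝ} (hF : 0 < F)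
    (hH : 0 < H) (hB : 0 ≤ B) (hX : 1 ≤ X) (h : (M : ℝ) ^ n ≤ F * H)
    (hlog : Real.log H ≤ B * X) :
    Real.log (M : ℝ) ≤ (|Real.log F| + B) * X := by
  rcases eq_or_lt_of_le hM with h0 | hpos
  · rw [← h0, Int.cast_zero, Real.log_zero]
    positivity
  · have hM1 : (1 : ℝ) ≤ M := by exact_mod_cast hpos
    have hlogM : 0 ≤ Real.log M := Real.log_nonneg hM1
    have h1 : (n : ℝ) * Real.log M ≤ Real.log F + Real.log H := by
      rw [← Real.log_pow, ← Real.log_mul hF.ne' hH.ne']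
      exact Real.log_le_log (by positivity) h
    have hn1 : (1 : ℝ) ≤ n := by exact_mod_cast Nat.one_le_iff_ne_zero.mpr hn
    have h2 : Real.log M ≤ (n : ℝ) * Real.log M := by nlinarith
    have h3 : |Real.log F| ≤ |Real.log F| * X := by nlinarith [abs_nonneg (Real.log F)]
    nlinarith [le_abs_self (Real.log F)]

/-- `max(|u|,|w|)^n ≤ (E_u + E_w + 1)·H` from `|u|^n ≤ E_u·H`, `|w|^n ≤ E_w·H`. [folklore] -/
theorem max_pow_le {n : ℕ} {u w : ℤ} {Eu Ew H : ℝ} (hEu : 0 ≤ Eu) (hEw : 0 ≤ Ew) (hH : 0 ≤ H)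
    (hu : |(u : ℝ)| ^ n ≤ Eu * H) (hw : |(w : ℝ)| ^ n ≤ Ew * H) :
    ((max |u| |w| : ℤ) : ℝ) ^ n ≤ (Eu + Ew + 1) * H := by
  push_cast
  rcases le_total |(u : ℝ)| |(w : ℝ)| with hle | hle
  · rw [max_eq_right hle]
    nlinarith
  · rw [max_eq_left hle]
    nlinarith

end NFPencilThreeForms

end Summit.ABC.ABC.Theorems
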